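import Summits.BirchSwinnertonDyer.BirchSwinnertonDyer.Theorems.BiquadraticEisensteinDescentHeegnerTwistCouplingInSupplyQuarticCornerAllP
import Summits.BirchSwinnertonDyer.BirchSwinnertonDyer.Theorems.BiquadraticEisensteinDescentHeegnerTwistCouplingInSupplyQuarticMinusTripleRowsHigh
import Summits.BirchSwinnertonDyer.BirchSwinnertonDyer.Theorems.BiquadraticEisensteinDescentHeegnerTwistCouplingInSupplyQuarticPlusThreeRowsHigh
import Literature.NumberTheory.EllipticCurves.ComplexMultiplicationLFunctionIsogenyHoldsProofs
import Literature.NumberTheory.EllipticCurves.LocalReductionKrausMinimality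
import HarnessLib

set_option linter.dupNamespace false -- `Summit.BirchSwinnertonDyer.BirchSwinnertonDyer.Theorems.…` (summit = sub)
set_option autoImplicit false

/-!
# Crux `HeegnerTwistCouplingInSupply` (stmt-BirchSwinnertonDyer-21381) — the QUARTIC `j = 1728` corner, the `2`-ISOGENOUS members
# `V_A : y² = x³ − 4A·x` of `X_A : y² = x³ + A·x` by TRANSPORT of the `L`-function (no new descent)

Route `BiquadraticEisensteinDescent` (cell `pub/bsd-wall`, width seat `bsd-wall-cm-bed-w4` g14; `--supports` 21381, helper). The curve
`V_A : y² = x³ − 4A x` is the codomain of the `2`-isogeny of `X_A : y² = x³ + A x` with kernel `(0,0)` (Silverman III.4.5), so for every `d` the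
twists `V_A^{(d)} = V_{Ad²}` and `X_A^{(d)} = X_{Ad²}` are `ℚ`-isogenous and have the SAME entire `L`-function — in the tree UNCONDITIONALLY:
`Literature.….entireLFunction_eq_of_isIsogenous'` (`LFunction_eq_of_isIsogenous_holds`, Knapp 11.67 proved `ℓ`-adically at every prime) with
`WeierstrassCurve.isIsogenous_of_eq_twoIsogenyCodomain`. For `A = ±p^k` (`k ∈ {{1,3}}`, `p` odd) `V_A` is another global minimal CM curve in the
crux's inert-bad corner (`v₂(4p^k) = 2 < 4`; `Δ = 2¹²·(∓p^{3k})`, conductor supported on `{2, p}`), bed-w4 g13's memo §5 (d) «isogeny-class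
transport … not started». This file transports the corner theorems of this seat and of bed-w3 g12 / bed-w2 g13 to the four isogenous families:

* §1 `entireLFunction_negFourMul_eq` (`L(V_B, s) = L(X_B, s)` for every integer `B ≠ 0`), the twist literal, the prime support of `N(V_A)`;
* §2 ★★ `cruxOnNegFourXCorner_of_BT` — `V = y² = x³ − 4p^k x`, EVERY prime `p ≡ 15 (mod 16)`, `k ∈ {1,3}` (cell data `exists_cellData_p_all` +
  `…QuarticCorner.L_one_ne_zero_X` + transport), and the binder-free ★★ `cruxOnNegFourXCorner` (Kraus at `2`: `isGloballyMinimal_negFourX`);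
* §3 ★★ `cruxOnNegFourXThreeCornerBelowTwenty_of_BT` — `V = y² = x³ − 4p x`, every prime `p ≡ 3 (mod 16)`, `19 ≤ p < 20000` (pair data);
* §4 ★★ `cruxOnFourWCornerBelowTwenty_of_BT` / ★★ `cruxOnFourWCubeCornerBelowTwenty_of_BT` — `V = y² = x³ + 4p x`, `y² = x³ + 4p³ x`, every prime
  `p ≡ 7 (mod 8)`, `23 ≤ p < 20000` (triple data).

Literals are integer casts `⟨0, 0, 0, ((A : ℤ) : ℚ), 0⟩` (the transport lemma's shape). HONEST FRAMING: four more typed sub-corners on ONE CM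
family (measure zero in «all CM `W`»); the crux (residual C⁺) is untouched; BSD is not proved by any of this. THEOREMS ONLY. Supports 21381.
-/

noncomputable section

open scoped Classical NumberField

namespace Summit.BirchSwinnertonDyer.BirchSwinnertonDyer.Theorems.BiquadraticEisensteinDescentHeegnerTwistCouplingInSupplyQuarticIsogenousMembers

open _root_.WeierstrassCurve Literature.NumberTheory.EllipticCurves Literature.NumberTheory.EllipticCurves.XCubeAddPX
open Literature.NumberTheory.QuadraticFields Literature.NumberTheory.QuadraticFields.Quadratic
open IsDedekindDomain Rat.HeightOneSpectrum
open Summit.BirchSwinnertonDyer.BirchSwinnertonDyer.Theorems.BiquadraticEisensteinDescentHeegnerTwistCouplingInSupplyQuarticCell (isElliptic_X)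
open Summit.BirchSwinnertonDyer.BirchSwinnertonDyer.Theorems.BiquadraticEisensteinDescentHeegnerTwistCouplingInSupplyQuarticCellPhiHat (b_pos)
open Summit.BirchSwinnertonDyer.BirchSwinnertonDyer.Theorems.BiquadraticEisensteinDescentHeegnerTwistCouplingInSupplyQuarticTwistCorner (lit_eq)
open Summit.BirchSwinnertonDyer.BirchSwinnertonDyer.Theorems.BiquadraticEisensteinDescentHeegnerTwistCouplingInSupplyQuarticCorner
  (L_one_ne_zero_X XInt_Δ)
open Summit.BirchSwinnertonDyer.BirchSwinnertonDyer.Theorems.BiquadraticEisensteinDescentHeegnerTwistCouplingInSupplyPartnerLadder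
  (exists_witnessField_of jacobiSym_neg_mul_eq_one)
open Summit.BirchSwinnertonDyer.BirchSwinnertonDyer.Theorems.BiquadraticEisensteinDescentHeegnerTwistCouplingInSupplyRoundingPinCellData
  (exists_cellData_p_all)
open Summit.BirchSwinnertonDyer.BirchSwinnertonDyer.Theorems.BiquadraticEisensteinDescentHeegnerTwistCouplingInSupplyQuarticPlusCorner
  (not_isSquare_of_jacobiSym_eq_neg_one)
open Summit.BirchSwinnertonDyer.BirchSwinnertonDyer.Theorems.BiquadraticEisensteinDescentHeegnerTwistCouplingInSupplyQuarticMinusTripleCorner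
  (L_one_ne_zero_triple_of_BT jacobiSym_neg_triple_eq_one not_isSquare_mod_of_jacobiSym_eq_neg_one exists_witnessField_triple)
open Summit.BirchSwinnertonDyer.BirchSwinnertonDyer.Theorems.BiquadraticEisensteinDescentHeegnerTwistCouplingInSupplyQuarticMinusTripleCubeCorner
  (L_one_ne_zero_triple_cube_of_BT)
open Summit.BirchSwinnertonDyer.BirchSwinnertonDyer.Theorems.BiquadraticEisensteinDescentHeegnerTwistCouplingInSupplyQuarticMinusTripleRowsHigh
  (exists_tripleData_of_lt_twenty)
open Summit.BirchSwinnertonDyer.BirchSwinnertonDyer.Theorems.BiquadraticEisensteinDescentHeegnerTwistCouplingInSupplyQuarticPlusThreeCorner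
  (L_one_ne_zero_plusThree_of_BT jacobiSym_neg_pair_eq_one not_isSquare_mod_of_jacobiSym_eq_one_three_mod_four exists_witnessField_pair)
open Summit.BirchSwinnertonDyer.BirchSwinnertonDyer.Theorems.BiquadraticEisensteinDescentHeegnerTwistCouplingInSupplyQuarticPlusThreeRowsHigh
  (exists_pairData_of_lt_twenty)

/-! ## §1 Transport along the `2`-isogeny `X_B → V_B`, the twist literal, the support of `N(V_A)` -/

section Transport

/-- **`L(V_B, s) = L(X_B, s)`** for `X_B : y² = x³ + Bx`, `V_B : y² = x³ − 4Bx` (`B ≠ 0`): `V_B` is the codomain of the `2`-isogeny of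
`X_B` with kernel `(0, 0)`, and `ℚ`-isogenous curves have the same entire `L`-function (tree theorem, Knapp 11.67 at every prime).
[cite: SilvermanAEC2009, III.4 Example 4.5] [cite: Knapp1993, Thm. 11.67] -/
theorem entireLFunction_negFourMul_eq {B : ℤ} [h1 : (⟨0, 0, 0, (B : ℚ), 0⟩ : WeierstrassCurve ℚ).IsElliptic]
    [h2 : (⟨0, 0, 0, (((-4 * B : ℤ)) : ℚ), 0⟩ : WeierstrassCurve ℚ).IsElliptic] :
    (⟨0, 0, 0, (((-4 * B : ℤ)) : ℚ), 0⟩ : WeierstrassCurve ℚ).entireLFunction =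
      (⟨0, 0, 0, (B : ℚ), 0⟩ : WeierstrassCurve ℚ).entireLFunction := by
  haveI : (⟨0, 0, 0, (B : ℚ), 0⟩ : WeierstrassCurve ℚ).IsTwoTorsionNF := ⟨rfl, rfl, rfl⟩
  have hc : (⟨0, 0, 0, (B : ℚ), 0⟩ : WeierstrassCurve ℚ).twoIsogenyCodomain = ⟨0, 0, 0, (((-4 * B : ℤ)) : ℚ), 0⟩ := by
    simp only [WeierstrassCurve.twoIsogenyCodomain]
    ext <;> push_cast <;> ring
  exact (entireLFunction_eq_of_isIsogenous' (WeierstrassCurve.isIsogenous_of_eq_twoIsogenyCodomain _ hc)).symm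

/-- The twist literal: `(y² = x³ + A x)^{(d)} = (y² = x³ + d²A·x)`, integer-cast form. [cite: SilvermanAEC2009, X.2 and X.5] -/
theorem quadraticTwist_lit (A d : ℤ) :
    (⟨0, 0, 0, (A : ℚ), 0⟩ : WeierstrassCurve ℚ).quadraticTwist (d : ℚ) = ⟨0, 0, 0, (((d ^ 2 * A : ℤ)) : ℚ), 0⟩ := by
  rw [quadraticTwist_mk]; ext <;> push_cast <;> ring

/-- The `ℤ`-model `⟨0, 0, 0, A, 0⟩` maps to the literal `⟨0, 0, 0, ↑A, 0⟩`. [folklore] -/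
theorem map_lit (A : ℤ) : (⟨0, 0, 0, A, 0⟩ : WeierstrassCurve ℤ).map (Int.castRingHom ℚ) = ⟨0, 0, 0, (A : ℚ), 0⟩ := by
  ext <;> simp [WeierstrassCurve.map]

/-- **`y² = x³ + A x` has good reduction at every prime `r ∤ 2A`** (`Δ = −64A³`). [cite: SilvermanAEC2009, VII.5 Prop. 5.1(a)] -/
theorem hasGoodReductionAtPrime_lit {A : ℤ} {r : ℕ} [Fact r.Prime] (hrA : ¬ (r : ℤ) ∣ 2 * A) :
    (⟨0, 0, 0, (A : ℚ), 0⟩ : WeierstrassCurve ℚ).HasGoodReductionAtPrime r := by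
  have hr : r.Prime := Fact.out
  have hrI : Prime (r : ℤ) := Nat.prime_iff_prime_int.mp hr
  obtain ⟨v, rfl⟩ : ∃ v : HeightOneSpectrum (𝓞 ℚ), (primesEquiv v : ℕ) = r :=
    ⟨primesEquiv.symm ⟨r, Fact.out⟩, by rw [Equiv.apply_symm_apply]⟩
  rw [← map_lit]
  refine (hasGoodReductionAtPrime_iff_hasGoodReductionAt_ringOfIntegers v _).2 (hasGoodReductionAt_map_of_not_dvd _ v ?_)
  rw [XInt_Δ]
  intro h
  rw [show (-64 * A ^ 3 : ℤ) = -(2 ^ 5 * (2 * A) * A ^ 2) by ring, dvd_neg] at h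
  rcases hrI.dvd_or_dvd h with h | h
  · rcases hrI.dvd_or_dvd h with h | h
    · exact hrA ((hrI.dvd_of_dvd_pow h).mul_right A)
    · exact hrA h
  · exact hrA ((hrI.dvd_of_dvd_pow h).mul_left 2)

/-- **Prime support of `N(y² = x³ + A x)`**: if every prime dividing `2A` is `2` or `p`, so is every prime dividing the conductor (no modularity).
[cite: SilvermanATAEC1994, Thm. IV.10.2(a)] -/
theorem eq_two_or_eq_of_prime_dvd_conductorNorm_lit {A : ℤ} {p r : ℕ} [(⟨0, 0, 0, (A : ℚ), 0⟩ : WeierstrassCurve ℚ).IsElliptic]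
    (hA : ∀ r : ℕ, r.Prime → (r : ℤ) ∣ 2 * A → r = 2 ∨ r = p) (hr : r.Prime)
    (h : r ∣ (⟨0, 0, 0, (A : ℚ), 0⟩ : WeierstrassCurve ℚ).conductorNorm ℤ) : r = 2 ∨ r = p := by
  by_contra hne
  have hrA : ¬ (r : ℤ) ∣ 2 * A := fun hd => hne (hA r hr hd)
  haveI : Fact r.Prime := ⟨hr⟩
  exact not_dvd_conductorNorm_of_hasGoodReductionAtPrime _ (hasGoodReductionAtPrime_lit hrA) h

/-- The support hypothesis for `A = c·p^k` with `c ∣ 4`... concretely: every prime dividing `2·(±4p^k)` is `2` or `p`. [folklore] -/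
theorem prime_dvd_two_mul_four_pow {p k r : ℕ} (hp : p.Prime) (hr : r.Prime) (ε : ℤ) (hε : ε = 1 ∨ ε = -1)
    (h : (r : ℤ) ∣ 2 * (ε * 4 * (p : ℤ) ^ k)) : r = 2 ∨ r = p := by
  have hrI : Prime (r : ℤ) := Nat.prime_iff_prime_int.mp hr
  have h' : (r : ℤ) ∣ 2 ^ 3 * (p : ℤ) ^ k := by
    rcases hε with rfl | rfl
    · rw [show (2 * (1 * 4 * (p : ℤ) ^ k)) = 2 ^ 3 * (p : ℤ) ^ k by ring] at h; exact h
    · rw [show (2 * (-1 * 4 * (p : ℤ) ^ k)) = -(2 ^ 3 * (p : ℤ) ^ k) by ring, dvd_neg] at h; exact h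
  rcases hrI.dvd_or_dvd h' with h2 | hp'
  · have : (r : ℤ) ∣ 2 := hrI.dvd_of_dvd_pow h2
    exact Or.inl ((Nat.prime_dvd_prime_iff_eq hr Nat.prime_two).mp (by exact_mod_cast this))
  · have : (r : ℤ) ∣ p := hrI.dvd_of_dvd_pow hp'
    exact Or.inr ((Nat.prime_dvd_prime_iff_eq hr hp).mp (by exact_mod_cast this))

end Transport

/-! ## §2 ★★ `V = y² = x³ − 4p^k x`, every prime `p ≡ 15 (mod 16)`, `k ∈ {1,3}` (partner `X_{p^k}`, all `p`) -/

section NegFourX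

/-- ★★ **THE ISOGENOUS CORNER `y² = x³ − 4p^k·x` FOR EVERY PRIME `p ≡ 15 (mod 16)`, `k ∈ {1, 3}`, ONE NAMED FACT.** Modulo Burungale–Tian ONLY
there is a Heegner field `K′ = ℚ(√−qℓ)` of `N(V)` (cell data `exists_cellData_p_all`) with `4 < |d_{K′}|`, `L(V^{(d_{K′})}, 1) ≠ 0`
(`= L(X_{p^k}^{(d_{K′})}, 1)` by transport, non-zero by `…QuarticCorner.L_one_ne_zero_X`), `h(K′) < p`, `p ∤ h(K′)` — the CONCLUSION of crux 21381
for `W = V`. [cite: BurungaleTian2026, Thm. 1.1] [cite: Knapp1993, Thm. 11.67] [cite: SilvermanAEC2009, Prop. X.4.9 and Thm. X.4.2(a)] -/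
theorem cruxOnNegFourXCorner_of_BT (hBT : burungaleTian_analyticRank_eq_zero_of_selmerCorank_eq_zero_of_hasCM) :
    ∀ (p k : ℕ) [Fact p.Prime] [(⟨0, 0, 0, (((-4 * (p : ℤ) ^ k : ℤ)) : ℚ), 0⟩ : WeierstrassCurve ℚ).IsElliptic]
      [(⟨0, 0, 0, (((-4 * (p : ℤ) ^ k : ℤ)) : ℚ), 0⟩ : WeierstrassCurve ℚ).IsGloballyMinimal]
      [NeZero ((⟨0, 0, 0, (((-4 * (p : ℤ) ^ k : ℤ)) : ℚ), 0⟩ : WeierstrassCurve ℚ).conductorNorm ℤ)],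
      p % 16 = 15 → (k = 1 ∨ k = 3) →
      ∃ (K : Type) (_ : Field K) (_ : NumberField K),
        IsImaginaryQuadratic K ∧ 4 < (NumberField.discr K).natAbs ∧
        SatisfiesHeegnerHypothesis ((⟨0, 0, 0, (((-4 * (p : ℤ) ^ k : ℤ)) : ℚ), 0⟩ : WeierstrassCurve ℚ).conductorNorm ℤ) K ∧
        ((⟨0, 0, 0, (((-4 * (p : ℤ) ^ k : ℤ)) : ℚ), 0⟩ : WeierstrassCurve ℚ).quadraticTwist (NumberField.discr K : ℚ)).entireLFunction 1 ≠ 0 ∧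
        NumberField.classNumber K < p ∧ ¬ p ∣ NumberField.classNumber K := by
  intro p k hpF _ _ _ hp16 hk
  have hp : p.Prime := hpF.out
  obtain ⟨q, l, hq, hq8, hl, hl8, hJq, hJl, hh⟩ := exists_cellData_p_all hp (by omega)
  obtain ⟨K, iF, iN, hK, hdK, hH', hcl⟩ := exists_witnessField_of
    (N := (⟨0, 0, 0, (((-4 * (p : ℤ) ^ k : ℤ)) : ℚ), 0⟩ : WeierstrassCurve ℚ).conductorNorm ℤ)
    hq hq8 hl hl8 (jacobiSym_neg_mul_eq_one (by omega) hJq hJl) hh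
    (fun r hr hrN => eq_two_or_eq_of_prime_dvd_conductorNorm_lit
      (fun r' hr' hd => prime_dvd_two_mul_four_pow hp hr' (-1) (Or.inr rfl) (by simpa [mul_comm, mul_assoc, mul_left_comm] using hd)) hr hrN)
  refine ⟨K, iF, iN, hK, ?_, hH', ?_, hcl, fun hdvd => absurd (Nat.le_of_dvd (NumberField.classNumber_pos K) hdvd) (not_le.mpr hcl)⟩
  · rw [hdK, Int.natAbs_neg, Int.natAbs_natCast]
    have h3 : 3 ≤ q := by have := hq.two_le; omega
    have h5 : 5 ≤ l := by have := hl.two_le; omega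
    calc 4 < 3 * 5 := by norm_num
      _ ≤ q * l := Nat.mul_le_mul h3 h5
  · rw [hdK, quadraticTwist_lit]
    rw [show ((-((q * l : ℕ) : ℤ)) ^ 2 * (-4 * (p : ℤ) ^ k) : ℤ) = -4 * ((p : ℤ) ^ k * q ^ 2 * l ^ 2) by push_cast; ring]
    have hB : ((p : ℤ) ^ k * q ^ 2 * l ^ 2 : ℤ) ≠ 0 := (b_pos (k := k) hp hq hl).ne'
    haveI := isElliptic_X hB
    haveI := isElliptic_X (show (-4 * ((p : ℤ) ^ k * q ^ 2 * l ^ 2) : ℤ) ≠ 0 from mul_ne_zero (by norm_num) hB)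
    rw [entireLFunction_negFourMul_eq]
    exact (L_one_ne_zero_X hBT hp hq hl hp16 hq8 hl8 hJq hJl hk).2

open Literature.NumberTheory.EllipticCurves.Rank1Residual.X11RankOneCertificates in
/-- **`y² = x³ − 4p^k·x` (`p` an odd prime, `k ≤ 3`) is a global minimal model**: `Δ = 2¹²·p^{3k}`, `c₄ = 2⁶·3·p^k`, `c₆ = 0`; at `q = 2` Kraus's
test passes (`2²⁴ ∤ Δ`, `2⁸ ∤ c₄`, `2⁸ ∤ c₆ + 2⁶ = 2⁶`), at odd `q` `q¹² ∤ Δ` (Silverman VII.1.1); the tree's `isGloballyMinimal_of_int_kraus`.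
[cite: Kraus1989, Prop. 2] [cite: SilvermanAEC2009, VII.1 Remark 1.1] -/
theorem isGloballyMinimal_negFourX {p : ℕ} (hp : p.Prime) (hp2 : p ≠ 2) {k : ℕ} (hk : k ≤ 3) :
    (⟨0, 0, 0, (((-4 * (p : ℤ) ^ k : ℤ)) : ℚ), 0⟩ : WeierstrassCurve ℚ).IsGloballyMinimal := by
  have h := isGloballyMinimal_of_int_kraus 0 0 0 (-4 * (p : ℤ) ^ k) 0 ?_
  · simpa only [Int.cast_zero] using h
  · intro q hq
    have hΔ : discOf [0, 0, 0, -4 * (p : ℤ) ^ k, 0] = 2 ^ 12 * ((p : ℤ) ^ k) ^ 3 := by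
      simp only [discOf, invariants]; ring
    have hc4 : c4Of [0, 0, 0, -4 * (p : ℤ) ^ k, 0] = 2 ^ 6 * (3 * (p : ℤ) ^ k) := by
      simp only [c4Of, invariants]; ring
    have hc6 : c6Of [0, 0, 0, -4 * (p : ℤ) ^ k, 0] = 0 := by
      simp only [c6Of, invariants]; ring
    have hpodd : ¬ (2 : ℤ) ∣ (p : ℤ) := fun h => hp2 ((Nat.prime_dvd_prime_iff_eq Nat.prime_two hp).mp (by exact_mod_cast h)).symm
    have h2I : Prime (2 : ℤ) := Int.prime_two
    by_cases hq2 : q = 2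
    · subst hq2
      refine Or.inr (Or.inl ⟨rfl, ?_, ?_, ?_⟩)
      · rw [hΔ]
        intro h
        have h' : (2 : ℤ) ^ 12 * 2 ^ 12 ∣ 2 ^ 12 * ((p : ℤ) ^ k) ^ 3 := by rw [← pow_add]; exact h
        have h'' : (2 : ℤ) ^ 12 ∣ ((p : ℤ) ^ k) ^ 3 := (mul_dvd_mul_iff_left (by norm_num)).mp h'
        exact hpodd (h2I.dvd_of_dvd_pow (h2I.dvd_of_dvd_pow (dvd_trans (dvd_pow_self 2 (by norm_num)) h'')))
      · rw [hc4]
        rintro ⟨h, -⟩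
        have h' : (2 : ℤ) ^ 6 * 2 ^ 2 ∣ 2 ^ 6 * (3 * (p : ℤ) ^ k) := by rw [← pow_add]; exact h
        have h'' : (2 : ℤ) ^ 2 ∣ 3 * (p : ℤ) ^ k := (mul_dvd_mul_iff_left (by norm_num)).mp h'
        rcases h2I.dvd_or_dvd (dvd_trans (dvd_pow_self 2 (by norm_num)) h'') with h3 | h3
        · norm_num at h3
        · exact hpodd (h2I.dvd_of_dvd_pow h3)
      · rw [hc6]; norm_num
    · refine Or.inl ?_
      rintro ⟨h12, -⟩
      rw [hΔ] at h12
      have hqI : Prime (q : ℤ) := Nat.prime_iff_prime_int.mp hq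
      have hcop : IsCoprime ((q : ℤ) ^ 12) ((2 : ℤ) ^ 12) := by
        apply IsCoprime.pow
        rw [Prime.coprime_iff_not_dvd hqI]
        intro h
        exact hq2 ((Nat.prime_dvd_prime_iff_eq hq Nat.prime_two).mp (by exact_mod_cast h))
      have h' : (q : ℤ) ^ 12 ∣ ((p : ℤ) ^ k) ^ 3 := hcop.dvd_of_dvd_mul_left h12
      have hqp : (q : ℤ) ∣ p := hqI.dvd_of_dvd_pow (hqI.dvd_of_dvd_pow (dvd_trans (dvd_pow_self _ (by norm_num)) h'))
      have hqeq : q = p := (Nat.prime_dvd_prime_iff_eq hq hp).mp (by exact_mod_cast hqp)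
      subst hqeq
      have h'' : q ^ 12 ∣ q ^ (k * 3) := by
        have := Int.natAbs_dvd_natAbs.mpr h'
        simpa [Int.natAbs_pow, ← pow_mul] using this
      have := (Nat.pow_dvd_pow_iff_le_right hq.one_lt).mp h''
      omega

/-- ★★ **The same corner with NO side binders** (`isElliptic_X`, `isGloballyMinimal_negFourX`, `conductorNorm_pos_holds`). [cite: BurungaleTian2026, Thm. 1.1] -/
theorem cruxOnNegFourXCorner (hBT : burungaleTian_analyticRank_eq_zero_of_selmerCorank_eq_zero_of_hasCM) :
    ∀ (p k : ℕ) [Fact p.Prime], p % 16 = 15 → (k = 1 ∨ k = 3) →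
      haveI := isElliptic_X (show (-4 * (p : ℤ) ^ k : ℤ) ≠ 0 from
        mul_ne_zero (by norm_num) (pow_ne_zero k (by exact_mod_cast (Fact.out : p.Prime).ne_zero)))
      ∃ (K : Type) (_ : Field K) (_ : NumberField K),
        IsImaginaryQuadratic K ∧ 4 < (NumberField.discr K).natAbs ∧
        SatisfiesHeegnerHypothesis ((⟨0, 0, 0, (((-4 * (p : ℤ) ^ k : ℤ)) : ℚ), 0⟩ : WeierstrassCurve ℚ).conductorNorm ℤ) K ∧
        ((⟨0, 0, 0, (((-4 * (p : ℤ) ^ k : ℤ)) : ℚ), 0⟩ : WeierstrassCurve ℚ).quadraticTwist (NumberField.discr K : ℚ)).entireLFunction 1 ≠ 0 ∧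
        NumberField.classNumber K < p ∧ ¬ p ∣ NumberField.classNumber K := by
  intro p k hpF hp16 hk
  have hp : p.Prime := hpF.out
  haveI := isElliptic_X (show (-4 * (p : ℤ) ^ k : ℤ) ≠ 0 from mul_ne_zero (by norm_num) (pow_ne_zero k (by exact_mod_cast hp.ne_zero)))
  haveI := isGloballyMinimal_negFourX hp (by rintro rfl; omega) (k := k) (by omega)
  haveI : NeZero ((⟨0, 0, 0, (((-4 * (p : ℤ) ^ k : ℤ)) : ℚ), 0⟩ : WeierstrassCurve ℚ).conductorNorm ℤ) :=
    ⟨((⟨0, 0, 0, (((-4 * (p : ℤ) ^ k : ℤ)) : ℚ), 0⟩ : WeierstrassCurve ℚ).conductorNorm_pos_holds).ne'⟩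
  exact cruxOnNegFourXCorner_of_BT hBT p k hp16 hk

end NegFourX

/-! ## §3 ★★ `V = y² = x³ − 4p x`, every prime `p ≡ 3 (mod 16)` below `20000` (partner `X_p`) -/

section NegFourXThree

/-- ★★ **THE ISOGENOUS CORNER `y² = x³ − 4p·x` FOR EVERY PRIME `p ≡ 3 (mod 16)`, `19 ≤ p < 20000`, ONE NAMED FACT** (pair data
`exists_pairData_of_lt_twenty`, transport to `X_p^{(−rt)}`, `…QuarticPlusThreeCorner.L_one_ne_zero_plusThree_of_BT`). [cite: BurungaleTian2026, Thm. 1.1]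
[cite: Knapp1993, Thm. 11.67] [cite: Cohen1993, §5.3.1 Algorithm 5.3.5] -/
theorem cruxOnNegFourXThreeCornerBelowTwenty_of_BT (hBT : burungaleTian_analyticRank_eq_zero_of_selmerCorank_eq_zero_of_hasCM) :
    ∀ (p : ℕ) [Fact p.Prime] [(⟨0, 0, 0, (((-4 * (p : ℤ) : ℤ)) : ℚ), 0⟩ : WeierstrassCurve ℚ).IsElliptic]
      [(⟨0, 0, 0, (((-4 * (p : ℤ) : ℤ)) : ℚ), 0⟩ : WeierstrassCurve ℚ).IsGloballyMinimal]
      [NeZero ((⟨0, 0, 0, (((-4 * (p : ℤ) : ℤ)) : ℚ), 0⟩ : WeierstrassCurve ℚ).conductorNorm ℤ)],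
      p % 16 = 3 → 19 ≤ p → p < 20000 →
      ∃ (K : Type) (_ : Field K) (_ : NumberField K),
        IsImaginaryQuadratic K ∧ 4 < (NumberField.discr K).natAbs ∧
        SatisfiesHeegnerHypothesis ((⟨0, 0, 0, (((-4 * (p : ℤ) : ℤ)) : ℚ), 0⟩ : WeierstrassCurve ℚ).conductorNorm ℤ) K ∧
        ((⟨0, 0, 0, (((-4 * (p : ℤ) : ℤ)) : ℚ), 0⟩ : WeierstrassCurve ℚ).quadraticTwist (NumberField.discr K : ℚ)).entireLFunction 1 ≠ 0 ∧
        NumberField.classNumber K < p ∧ ¬ p ∣ NumberField.classNumber K := by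
  intro p hpF _ _ _ hp16 h19 h20000
  have hp : p.Prime := hpF.out
  obtain ⟨r, t, hr, ht, hr8, ht8, hJr, hJt, hh⟩ := exists_pairData_of_lt_twenty hp hp16 h19 h20000
  haveI := Fact.mk hr; haveI := Fact.mk ht
  obtain ⟨K, iF, iN, hK, hdK, hH', hcl⟩ := exists_witnessField_pair
    (N := (⟨0, 0, 0, (((-4 * (p : ℤ) : ℤ)) : ℚ), 0⟩ : WeierstrassCurve ℚ).conductorNorm ℤ)
    hr hr8 ht ht8 (jacobiSym_neg_pair_eq_one (by omega) hJr hJt) hh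
    (fun u hu huN => eq_two_or_eq_of_prime_dvd_conductorNorm_lit
      (fun r' hr' hd => prime_dvd_two_mul_four_pow (k := 1) hp hr' (-1) (Or.inr rfl) (by simpa [mul_comm, mul_assoc, mul_left_comm] using hd))
      hu huN)
  refine ⟨K, iF, iN, hK, ?_, hH', ?_, hcl, fun hdvd => absurd (Nat.le_of_dvd (NumberField.classNumber_pos K) hdvd) (not_le.mpr hcl)⟩
  · rw [hdK, Int.natAbs_neg, Int.natAbs_natCast]
    have h9 : 9 ≤ r := by have := hr.two_le; omega
    have h7 : 7 ≤ t := by have := ht.two_le; omega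
    calc 4 < 9 * 7 := by norm_num
      _ ≤ r * t := Nat.mul_le_mul h9 h7
  · rw [hdK, quadraticTwist_lit]
    rw [show ((-((r * t : ℕ) : ℤ)) ^ 2 * (-4 * (p : ℤ)) : ℤ) = -4 * (r ^ 2 * t ^ 2 * p : ℤ) by push_cast; ring]
    have hB : (r ^ 2 * t ^ 2 * p : ℤ) ≠ 0 := mul_ne_zero (mul_ne_zero (pow_ne_zero 2 (by exact_mod_cast hr.ne_zero))
      (pow_ne_zero 2 (by exact_mod_cast ht.ne_zero))) (by exact_mod_cast hp.ne_zero)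
    haveI := isElliptic_X hB
    haveI := isElliptic_X (show (-4 * (r ^ 2 * t ^ 2 * p : ℤ) : ℤ) ≠ 0 from mul_ne_zero (by norm_num) hB)
    rw [entireLFunction_negFourMul_eq, ← lit_eq]
    haveI : (⟨0, ((0 : ℤ) : ℚ), 0, ((r ^ 2 * t ^ 2 * p : ℤ) : ℚ), 0⟩ : WeierstrassCurve ℚ).IsElliptic := by rw [lit_eq]; infer_instance
    exact (L_one_ne_zero_plusThree_of_BT hBT hp16 hr8 ht8 (not_isSquare_mod_of_jacobiSym_eq_neg_one (by omega) (by omega) hJr)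
      (not_isSquare_mod_of_jacobiSym_eq_one_three_mod_four (by omega) (by omega) hJt)).2

end NegFourXThree

/-! ## §4 ★★ `V = y² = x³ + 4p x` and `y² = x³ + 4p³ x`, every prime `p ≡ 7 (mod 8)` below `20000` (partners `W_p⁻`, `W_{p³}⁻`) -/

section FourW

/-- ★★ **THE ISOGENOUS CORNERS `y² = x³ + 4p^k·x` (`k ∈ {1,3}`) FOR EVERY PRIME `p ≡ 7 (mod 8)`, `23 ≤ p < 20000`, ONE NAMED FACT** (triple data
`exists_tripleData_of_lt_twenty`, transport to `(W_{p^k}⁻)^{(−sqℓ)}`, `L_one_ne_zero_triple_of_BT` / `L_one_ne_zero_triple_cube_of_BT`).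
[cite: BurungaleTian2026, Thm. 1.1] [cite: Knapp1993, Thm. 11.67] [cite: Cohen1993, §5.3.1 Algorithm 5.3.5] -/
theorem cruxOnFourWCornerBelowTwenty_of_BT (hBT : burungaleTian_analyticRank_eq_zero_of_selmerCorank_eq_zero_of_hasCM) :
    ∀ (p k : ℕ) [Fact p.Prime] [(⟨0, 0, 0, (((-4 * -((p : ℤ) ^ k) : ℤ)) : ℚ), 0⟩ : WeierstrassCurve ℚ).IsElliptic]
      [(⟨0, 0, 0, (((-4 * -((p : ℤ) ^ k) : ℤ)) : ℚ), 0⟩ : WeierstrassCurve ℚ).IsGloballyMinimal]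
      [NeZero ((⟨0, 0, 0, (((-4 * -((p : ℤ) ^ k) : ℤ)) : ℚ), 0⟩ : WeierstrassCurve ℚ).conductorNorm ℤ)],
      p % 8 = 7 → (k = 1 ∨ k = 3) → 23 ≤ p → p < 20000 →
      ∃ (K : Type) (_ : Field K) (_ : NumberField K),
        IsImaginaryQuadratic K ∧ 4 < (NumberField.discr K).natAbs ∧
        SatisfiesHeegnerHypothesis ((⟨0, 0, 0, (((-4 * -((p : ℤ) ^ k) : ℤ)) : ℚ), 0⟩ : WeierstrassCurve ℚ).conductorNorm ℤ) K ∧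
        ((⟨0, 0, 0, (((-4 * -((p : ℤ) ^ k) : ℤ)) : ℚ), 0⟩ : WeierstrassCurve ℚ).quadraticTwist (NumberField.discr K : ℚ)).entireLFunction 1 ≠ 0 ∧
        NumberField.classNumber K < p ∧ ¬ p ∣ NumberField.classNumber K := by
  intro p k hpF _ _ _ hp8 hk h23 h20000
  have hp : p.Prime := hpF.out
  obtain ⟨s, q, l, hs, hq, hl, hs8, hq8, hl8, hJs, hJq, hJl, hh⟩ := exists_tripleData_of_lt_twenty hp hp8 h23 h20000
  haveI := Fact.mk hs; haveI := Fact.mk hq; haveI := Fact.mk hl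
  obtain ⟨K, iF, iN, hK, hdK, hH', hcl⟩ := exists_witnessField_triple
    (N := (⟨0, 0, 0, (((-4 * -((p : ℤ) ^ k) : ℤ)) : ℚ), 0⟩ : WeierstrassCurve ℚ).conductorNorm ℤ)
    hs hs8 hq hq8 hl hl8 (jacobiSym_neg_triple_eq_one (by omega) hJs hJq hJl) hh
    (fun u hu huN => eq_two_or_eq_of_prime_dvd_conductorNorm_lit
      (fun r' hr' hd => prime_dvd_two_mul_four_pow (k := k) hp hr' 1 (Or.inl rfl) (by simpa [mul_comm, mul_assoc, mul_left_comm] using hd))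
      hu huN)
  refine ⟨K, iF, iN, hK, ?_, hH', ?_, hcl, fun hdvd => absurd (Nat.le_of_dvd (NumberField.classNumber_pos K) hdvd) (not_le.mpr hcl)⟩
  · rw [hdK, Int.natAbs_neg, Int.natAbs_natCast]
    have h9 : 9 ≤ s := by have := hs.two_le; omega
    have h3 : 3 ≤ q := by have := hq.two_le; omega
    have h5 : 5 ≤ l := by have := hl.two_le; omega
    calc 4 < 9 * 3 * 5 := by norm_num
      _ ≤ s * q * l := Nat.mul_le_mul (Nat.mul_le_mul h9 h3) h5
  · have hnq := not_isSquare_of_jacobiSym_eq_neg_one hJq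
    have hps := not_isSquare_mod_of_jacobiSym_eq_neg_one (t := s) (by omega) (by omega) hJs
    have hpl := not_isSquare_mod_of_jacobiSym_eq_neg_one (t := l) (by omega) (by omega) hJl
    rw [hdK, quadraticTwist_lit]
    rcases hk with rfl | rfl
    · rw [show ((-((s * q * l : ℕ) : ℤ)) ^ 2 * (-4 * -((p : ℤ) ^ 1)) : ℤ) = -4 * (-(s ^ 2 * q ^ 2 * l ^ 2 * p) : ℤ) by push_cast; ring]
      have hB : (-(s ^ 2 * q ^ 2 * l ^ 2 * p) : ℤ) ≠ 0 := neg_ne_zero.mpr (mul_ne_zero (mul_ne_zero (mul_ne_zero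
        (pow_ne_zero 2 (by exact_mod_cast hs.ne_zero)) (pow_ne_zero 2 (by exact_mod_cast hq.ne_zero)))
        (pow_ne_zero 2 (by exact_mod_cast hl.ne_zero))) (by exact_mod_cast hp.ne_zero))
      haveI := isElliptic_X hB
      haveI := isElliptic_X (show (-4 * -(s ^ 2 * q ^ 2 * l ^ 2 * p : ℤ) : ℤ) ≠ 0 from mul_ne_zero (by norm_num) hB)
      rw [entireLFunction_negFourMul_eq, ← lit_eq]
      haveI : (⟨0, ((0 : ℤ) : ℚ), 0, ((-(s ^ 2 * q ^ 2 * l ^ 2 * p) : ℤ) : ℚ), 0⟩ : WeierstrassCurve ℚ).IsElliptic := by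
        rw [lit_eq]; infer_instance
      exact (L_one_ne_zero_triple_of_BT hBT hp8 hs8 hq8 hl8 hnq hps hpl).2
    · rw [show ((-((s * q * l : ℕ) : ℤ)) ^ 2 * (-4 * -((p : ℤ) ^ 3)) : ℤ) = -4 * (-(s ^ 2 * q ^ 2 * l ^ 2 * p ^ 3) : ℤ) by push_cast; ring]
      have hB : (-(s ^ 2 * q ^ 2 * l ^ 2 * p ^ 3) : ℤ) ≠ 0 := neg_ne_zero.mpr (mul_ne_zero (mul_ne_zero (mul_ne_zero
        (pow_ne_zero 2 (by exact_mod_cast hs.ne_zero)) (pow_ne_zero 2 (by exact_mod_cast hq.ne_zero)))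
        (pow_ne_zero 2 (by exact_mod_cast hl.ne_zero))) (pow_ne_zero 3 (by exact_mod_cast hp.ne_zero)))
      haveI := isElliptic_X hB
      haveI := isElliptic_X (show (-4 * -(s ^ 2 * q ^ 2 * l ^ 2 * p ^ 3 : ℤ) : ℤ) ≠ 0 from mul_ne_zero (by norm_num) hB)
      rw [entireLFunction_negFourMul_eq, ← lit_eq]
      haveI : (⟨0, ((0 : ℤ) : ℚ), 0, ((-(s ^ 2 * q ^ 2 * l ^ 2 * p ^ 3) : ℤ) : ℚ), 0⟩ : WeierstrassCurve ℚ).IsElliptic := by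
        rw [lit_eq]; infer_instance
      exact (L_one_ne_zero_triple_cube_of_BT hBT hp8 hs8 hq8 hl8 hnq hps hpl).2

end FourW

end Summit.BirchSwinnertonDyer.BirchSwinnertonDyer.Theorems.BiquadraticEisensteinDescentHeegnerTwistCouplingInSupplyQuarticIsogenousMembers

end
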